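import Mathlib
import HarnessLib
import Literature.MathematicalPhysics.QuantumFieldTheory.ConstructiveQFTWave0
import Literature.MathematicalPhysics.QuantumLattice.AbelianFieldTensor
import Literature.MathematicalPhysics.QuantumLattice.AbelianMagneticFlux
import Summits.Ventures.LatticeQCDFlow.Scaling.TopologicalCollar
import Summits.Ventures.LatticeQCDFlow.Scaling.FluxSectorCollar
import Summits.Ventures.LatticeQCDFlow.Scaling.SectorConfinement
import Summits.Ventures.LatticeQCDFlow.Scaling.FluxPatch

/-!
# LatticeQCDFlow / Scaling — TUNNELLING LAWS II(b): the `U(1)` flux sector — the SMALL-STEP separating set (plane collar)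

HONEST FRAMING: exact (Metropolis-corrected) sampling algorithms for lattice gauge theory;
figures of merit are autocorrelation/cost numbers at stated couplings and volumes; no
continuum-physics claim.

THEORY-2.md §3.3 (v3.0, theory seat GEN-17).  SMALL STEPS (HMC / Langevin / ODE-flow steps, any update moving
every link by `≤ ρ` in chordal distance, or more generally moving the four links of each plane plaquette by
`≤ r` in total): if `Q(U) ≠ Q(U')` then some plaquette of the `(μ,ν)`-plane of `U` is within chordal distance
`r` (resp. `4ρ`) of `-1` (`mem_planeCollar_of_topCharge_ne`, `mem_planeCollar_of_dist_le_of_topCharge_ne`).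
Proof: along the linkwise geodesic path `anglePath U U'` of `Scaling/FluxSectorCollar.lean` every plane
plaquette stays within its total link displacement of its initial value (`dist_plaquetteHolonomy_anglePath_le`,
from `Lattice.Circle.dist_plaquettePattern_le` of `Scaling/TopologicalCollar.lean`), so it never meets `-1`, and
the charge — a continuous integer off the plane defect set — is constant along the path
(`topCharge_comp_eq_of_preconnected_plane`, the plane-local sharpening of `Scaling/SectorConfinement.lean`).
Compact `U(1)`, every `d`, every `L ≥ 1`, no hypothesis on any measure.  The laws are assembled in
`Scaling/FluxTunnelling.lean`.
-/

noncomputable section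

namespace Summit.Ventures.LatticeQCDFlow.Theory2.Lattice.Flux

open MeasureTheory ProbabilityTheory Metric Set Filter Topology Real
open scoped ENNReal
open Literature.MathematicalPhysics.QuantumFieldTheory Literature.MathematicalPhysics.QuantumLattice

variable {d L : ℕ}

variable [NeZero L]

/-! ## §3. Small steps: a charge change needs a plane plaquette near `-1` -/

/-- The four-link displacement of a plaquette is at most `4·dist U U'` (sup metric). [folklore] -/
theorem plaqDisp_le_four_mul_dist (U U' : GaugeConfig d L Circle) (x : Site d L) (μ ν : Fin d) :
    plaqDisp U U' x μ ν ≤ 4 * dist U U' := by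
  unfold plaqDisp
  linarith [dist_le_pi_dist U U' (x, μ), dist_le_pi_dist U U' (x.shift μ, ν),
    dist_le_pi_dist U U' (x.shift ν, μ), dist_le_pi_dist U U' (x, ν)]

omit [NeZero L] in
/-- Along the linkwise geodesic path from `U` to `U'`, each plaquette stays within the total
displacement of its four links of its initial value. [folklore] -/
theorem dist_plaquetteHolonomy_anglePath_le (U U' : GaugeConfig d L Circle) {t : ℝ}
    (ht : t ∈ Icc (0 : ℝ) 1) (x : Site d L) (μ ν : Fin d) :
    dist (plaquetteHolonomy (anglePath U U' t) x μ ν) (plaquetteHolonomy U x μ ν) ≤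
      plaqDisp U U' x μ ν := by
  have hlink : ∀ e : Edge d L, dist (anglePath U U' t e) (U e) ≤ dist (U e) (U' e) := by
    intro e
    have hδ : |Complex.arg ((U' e / U e : Circle) : ℂ)| ≤ π :=
      abs_le.2 ⟨(Complex.neg_pi_lt_arg _).le, Complex.arg_le_pi _⟩
    have hU' : U' e = Circle.exp (Complex.arg ((U' e / U e : Circle) : ℂ)) * U e := by
      rw [Circle.exp_arg]; exact (div_mul_cancel (U' e) (U e)).symm
    calc dist (anglePath U U' t e) (U e)
        = dist (Circle.exp (t * Complex.arg ((U' e / U e : Circle) : ℂ)) * U e) (U e) := rfl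
      _ ≤ dist (Circle.exp (Complex.arg ((U' e / U e : Circle) : ℂ)) * U e) (U e) :=
          Circle.dist_exp_mul_le_of_mem_Icc hδ ht (U e)
      _ = dist (U e) (U' e) := by rw [← hU', dist_comm]
  have h := Circle.dist_plaquettePattern_le (anglePath U U' t (x, μ)) (anglePath U U' t (x.shift μ, ν))
    (anglePath U U' t (x.shift ν, μ)) (anglePath U U' t (x, ν)) (U (x, μ)) (U (x.shift μ, ν))
    (U (x.shift ν, μ)) (U (x, ν))
  unfold plaquetteHolonomy plaqDisp
  linarith [hlink (x, μ), hlink (x.shift μ, ν), hlink (x.shift ν, μ), hlink (x, ν)]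

omit [NeZero L] in
/-- The field tensor of a plaquette is continuous at every configuration where that plaquette is not
`-1`. [folklore] -/
theorem continuousAt_abelianFieldTensor {U : GaugeConfig d L Circle} {x : Site d L} {μ ν : Fin d}
    (hU : plaquetteHolonomy U x μ ν ≠ -1) :
    ContinuousAt (fun V : GaugeConfig d L Circle => abelianFieldTensor V x μ ν) U := by
  have hc : Continuous fun V : GaugeConfig d L Circle => ((plaquetteHolonomy V x μ ν : Circle) : ℂ) :=
    continuous_subtype_val.comp (continuous_plaquetteHolonomy x μ ν)
  exact ContinuousAt.comp (g := Complex.arg)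
    (f := fun V : GaugeConfig d L Circle => ((plaquetteHolonomy V x μ ν : Circle) : ℂ))
    (Complex.continuousAt_arg (Circle.mem_slitPlane_of_ne_neg_one _ hU)) hc.continuousAt

/-- **Plane-local sector confinement.**  A continuous family of configurations from a preconnected
parameter space, none of whose PLANE plaquettes is ever `-1`, has constant plane charge (other
plaquettes are unrestricted). [folklore] -/
theorem topCharge_comp_eq_of_preconnected_plane {Y : Type*} [TopologicalSpace Y] [PreconnectedSpace Y]
    {T : Y → GaugeConfig d L Circle} (hT : Continuous T) (x₀ : Site d L) (μ ν : Fin d)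
    (hD : ∀ y (p : ZMod L × ZMod L), plaquetteHolonomy (T y) (planeSite x₀ μ ν p) μ ν ≠ -1) (y y' : Y) :
    topCharge x₀ μ ν (T y) = topCharge x₀ μ ν (T y') := by
  have hc : Continuous fun z => topCharge x₀ μ ν (T z) := by
    have e : (fun z => topCharge x₀ μ ν (T z)) = fun z =>
        (∑ p : ZMod L × ZMod L, abelianFieldTensor (T z) (planeSite x₀ μ ν p) μ ν) / (2 * π) := by
      funext z; rw [topCharge, magneticFlux_eq_sum_plane]
    rw [e]
    refine Continuous.div_const (continuous_finsetSum _ fun p _ => ?_) _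
    exact continuous_iff_continuousAt.2 fun z =>
      (continuousAt_abelianFieldTensor (hD z p)).comp hT.continuousAt
  by_contra hne
  obtain ⟨n, hn⟩ := exists_int_eq_topCharge x₀ μ ν (T y)
  obtain ⟨n', hn'⟩ := exists_int_eq_topCharge x₀ μ ν (T y')
  rcases lt_or_gt_of_ne hne with hlt | hlt
  · have hnn : n < n' := by
      have : (n : ℝ) < n' := by rw [← hn, ← hn']; exact hlt
      exact_mod_cast this
    have hmem : ((n : ℝ) + 1 / 2) ∈ Icc (topCharge x₀ μ ν (T y)) (topCharge x₀ μ ν (T y')) := by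
      rw [hn, hn']
      have : (n : ℝ) + 1 ≤ n' := by exact_mod_cast hnn
      exact ⟨by linarith, by linarith⟩
    obtain ⟨z, hz⟩ := intermediate_value_univ y y' hc hmem
    exact topCharge_ne_int_add_half x₀ μ ν (T z) n hz
  · have hnn : n' < n := by
      have : (n' : ℝ) < n := by rw [← hn, ← hn']; exact hlt
      exact_mod_cast this
    have hmem : ((n' : ℝ) + 1 / 2) ∈ Icc (topCharge x₀ μ ν (T y')) (topCharge x₀ μ ν (T y)) := by
      rw [hn, hn']
      have : (n' : ℝ) + 1 ≤ n := by exact_mod_cast hnn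
      exact ⟨by linarith, by linarith⟩
    obtain ⟨z, hz⟩ := intermediate_value_univ y' y hc hmem
    exact topCharge_ne_int_add_half x₀ μ ν (T z) n' hz

/-- **Small-step lemma.**  If the four links of every plane plaquette move by less (in total chordal
displacement) than that plaquette's chordal distance to `-1`, the plane charge does not change.
[folklore] -/
theorem topCharge_eq_of_plaqDisp_lt (x₀ : Site d L) (μ ν : Fin d) {U U' : GaugeConfig d L Circle}
    (h : ∀ p : ZMod L × ZMod L, plaqDisp U U' (planeSite x₀ μ ν p) μ ν <
      ‖((plaquetteHolonomy U (planeSite x₀ μ ν p) μ ν : Circle) : ℂ) + 1‖) :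
    topCharge x₀ μ ν U = topCharge x₀ μ ν U' := by
  haveI : PreconnectedSpace (Icc (0 : ℝ) 1) := Subtype.preconnectedSpace isPreconnected_Icc
  have hT : Continuous fun t : Icc (0 : ℝ) 1 => anglePath U U' (t : ℝ) :=
    (continuous_anglePath U U').comp continuous_subtype_val
  have hD : ∀ (t : Icc (0 : ℝ) 1) (p : ZMod L × ZMod L),
      plaquetteHolonomy (anglePath U U' (t : ℝ)) (planeSite x₀ μ ν p) μ ν ≠ -1 := by
    intro t p ht
    have hd := dist_plaquetteHolonomy_anglePath_le U U' t.2 (planeSite x₀ μ ν p) μ ν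
    rw [ht, U1.dist_eq_norm_coe] at hd
    have e : ((-1 : Circle) : ℂ) - ((plaquetteHolonomy U (planeSite x₀ μ ν p) μ ν : Circle) : ℂ) =
        -(((plaquetteHolonomy U (planeSite x₀ μ ν p) μ ν : Circle) : ℂ) + 1) := by
      rw [Circle.coe_neg, Circle.coe_one]; ring
    rw [e, norm_neg] at hd
    exact absurd (h p) (not_lt.mpr hd)
  have key := topCharge_comp_eq_of_preconnected_plane hT x₀ μ ν hD ⟨0, left_mem_Icc.2 zero_le_one⟩
    ⟨1, right_mem_Icc.2 zero_le_one⟩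
  simpa only [anglePath_zero, anglePath_one] using key

/-- **Separating set for per-plaquette-small moves.**  If the four links of every plane plaquette move
by at most `r` in total and the charge changes, the initial configuration lies in the plane collar of
width `r`. [folklore] -/
theorem mem_planeCollar_of_topCharge_ne (x₀ : Site d L) (μ ν : Fin d) {U U' : GaugeConfig d L Circle}
    {r : ℝ} (hr : ∀ p : ZMod L × ZMod L, plaqDisp U U' (planeSite x₀ μ ν p) μ ν ≤ r)
    (hQ : topCharge x₀ μ ν U ≠ topCharge x₀ μ ν U') : U ∈ planeCollar x₀ μ ν r := by
  by_contra hU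
  refine hQ (topCharge_eq_of_plaqDisp_lt x₀ μ ν fun p => ?_)
  have hp : ¬ ‖((plaquetteHolonomy U (planeSite x₀ μ ν p) μ ν : Circle) : ℂ) + 1‖ ≤ r :=
    fun hp => hU ⟨p, hp⟩
  exact lt_of_le_of_lt (hr p) (not_le.mp hp)

/-- **Separating set for sup-small moves.**  If every link moves by at most `ρ` (sup chordal metric)
and the charge changes, the initial configuration lies in the plane collar of width `4ρ`. [folklore] -/
theorem mem_planeCollar_of_dist_le_of_topCharge_ne (x₀ : Site d L) (μ ν : Fin d)
    {U U' : GaugeConfig d L Circle} {ρ : ℝ} (hρ : dist U U' ≤ ρ)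
    (hQ : topCharge x₀ μ ν U ≠ topCharge x₀ μ ν U') : U ∈ planeCollar x₀ μ ν (4 * ρ) :=
  mem_planeCollar_of_topCharge_ne x₀ μ ν
    (fun p => (plaqDisp_le_four_mul_dist U U' _ μ ν).trans (by linarith)) hQ

end Summit.Ventures.LatticeQCDFlow.Theory2.Lattice.Flux
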